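import Mathlib

/-!
# T5ComponentSum — the connected components of the (possibly disconnected) surface S

Tier-5 support for sub-step N1 (Hodge-theoretic side; memo route/T5-N1-hodge-p6.md §H5–H7):
the memo argues on a connected component `S_j` of the compact surface `S = ⊔_j S_j` and then
sums over `j`.  This file records the topological and measure-theoretic bookkeeping behind
«let `S_j` be a connected component of `S`»:

* the component of a point, as a set, is `component c = mk ⁻¹' {c}` for `c : ConnectedComponents S`;
  the components are connected, pairwise disjoint and cover `S`;
* for a locally connected `S` every component is clopen (Mathlib `isClopen_connectedComponent`),
  and a locally connected compact `S` has finitely many components (Mathlib's instance);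
* each component is itself a compact connected space (the hypotheses of the global identity
  principle of `T5IdentityPrincipleGlobal`), and locally connected;
* the integral of an integrable map over `S` is the finite sum of its integrals over the
  components (`integral_eq_sum_component`), so a period `∫_S α ∧ β̄ ≠ 0` is non-zero on at least
  one component (`exists_setIntegral_ne_zero`), and a non-negative integrand integrates to `0`
  on `S` iff it does on every component (`integral_eq_zero_iff_forall_component`);
* a map on `S` is zero iff it is zero on every component (`eq_zero_iff_forall_component`).

Blind lane (cell pub-hodge-repro2): `import Mathlib` only, 0 sorry, standard axioms.
-/

namespace Summit.Ventures.HodgeRepro2.T5ComponentSum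

open MeasureTheory Set Topology Function

variable {S : Type*} [TopologicalSpace S]

/-- The connected component `c : ConnectedComponents S` as a subset of `S`: the fibre of the
quotient map `ConnectedComponents.mk` over `c`. -/
def component (c : ConnectedComponents S) : Set S :=
  ConnectedComponents.mk ⁻¹' {c}

/-- Membership in a component. -/
theorem mem_component {c : ConnectedComponents S} {x : S} :
    x ∈ component c ↔ ConnectedComponents.mk x = c := Iff.rfl

/-- The component of the class of `x` is the connected component of `x`. -/
theorem component_mk (x : S) :
    component (ConnectedComponents.mk x) = connectedComponent x :=
  connectedComponents_preimage_singleton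

/-- Every point lies in the component of its own class. -/
theorem mem_component_mk (x : S) : x ∈ component (ConnectedComponents.mk x) := rfl

/-- Every component is connected (in particular non-empty). -/
theorem isConnected_component (c : ConnectedComponents S) : IsConnected (component c) := by
  obtain ⟨x, rfl⟩ := ConnectedComponents.surjective_coe c
  rw [component_mk]
  exact isConnected_connectedComponent

/-- Every component is non-empty. -/
theorem nonempty_component (c : ConnectedComponents S) : (component c).Nonempty :=
  (isConnected_component c).nonempty

/-- Every component is closed. -/
theorem isClosed_component (c : ConnectedComponents S) : IsClosed (component c) := by
  obtain ⟨x, rfl⟩ := ConnectedComponents.surjective_coe c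
  rw [component_mk]
  exact isClosed_connectedComponent

/-- The components cover `S`. -/
theorem iUnion_component : ⋃ c : ConnectedComponents S, component c = univ := by
  ext x
  simp only [mem_iUnion, mem_univ, iff_true]
  exact ⟨_, mem_component_mk x⟩

/-- Distinct components are disjoint. -/
theorem pairwise_disjoint_component :
    Pairwise (Disjoint on (component : ConnectedComponents S → Set S)) := by
  intro c d hcd
  rw [Function.onFun, Set.disjoint_left]
  intro x hx hx'
  exact hcd (hx.symm.trans hx')

/-- `S` is the disjoint union of its components (the statement used for the integral). -/
theorem iUnion_component_eq_univ_and_pairwise_disjoint :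
    (⋃ c : ConnectedComponents S, component c = univ) ∧
      Pairwise (Disjoint on (component : ConnectedComponents S → Set S)) :=
  ⟨iUnion_component, pairwise_disjoint_component⟩

/-- Each component, as a subspace, is a connected space — the hypothesis `ConnectedSpace` of the
global identity principle (`T5IdentityPrincipleGlobal`) holds on every `S_j`. -/
theorem connectedSpace_component (c : ConnectedComponents S) : ConnectedSpace (component c) :=
  isConnected_iff_connectedSpace.mp (isConnected_component c)

/-- Each component of a compact space is compact (closed in a compact space). -/
theorem isCompact_component [CompactSpace S] (c : ConnectedComponents S) :
    IsCompact (component c) :=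
  (isClosed_component c).isCompact

/-- Each component of a compact space is a compact space. -/
theorem compactSpace_component [CompactSpace S] (c : ConnectedComponents S) :
    CompactSpace (component c) :=
  isCompact_iff_compactSpace.mp (isCompact_component c)

section LocallyConnected

variable [LocallyConnectedSpace S]

/-- On a locally connected space every component is open. -/
theorem isOpen_component (c : ConnectedComponents S) : IsOpen (component c) := by
  obtain ⟨x, rfl⟩ := ConnectedComponents.surjective_coe c
  rw [component_mk]
  exact isOpen_connectedComponent

/-- On a locally connected space every component is clopen (Mathlib
`isClopen_connectedComponent`). -/
theorem isClopen_component (c : ConnectedComponents S) : IsClopen (component c) :=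
  ⟨isClosed_component c, isOpen_component c⟩

/-- Each component, as a subspace, is again locally connected (an open subset of a locally
connected space). -/
theorem locallyConnectedSpace_component (c : ConnectedComponents S) :
    LocallyConnectedSpace (component c) :=
  (isOpen_component c).locallyConnectedSpace

/-- A locally connected compact space has finitely many components (Mathlib's instance, recorded
here by name: the surface `S` has finitely many `S_j`). -/
theorem finite_components [CompactSpace S] : Finite (ConnectedComponents S) :=
  inferInstance

/-- On a locally connected space the components are measurable for any Borel-compatible
σ-algebra. -/
theorem measurableSet_component [MeasurableSpace S] [OpensMeasurableSpace S]
    (c : ConnectedComponents S) : MeasurableSet (component c) :=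
  (isOpen_component c).measurableSet

end LocallyConnected

section Integrable

variable [MeasurableSpace S] [OpensMeasurableSpace S] {μ : Measure S}
  {E : Type*} [NormedAddCommGroup E]

/-- A continuous map on a compact space is integrable for a measure finite on compacts. -/
theorem integrable_of_continuous [CompactSpace S] [IsFiniteMeasureOnCompacts μ] {f : S → E}
    (hf : Continuous f) : Integrable f μ :=
  hf.integrable_of_hasCompactSupport (HasCompactSupport.of_compactSpace f)

end Integrable

section Integral

variable [LocallyConnectedSpace S] [MeasurableSpace S] [OpensMeasurableSpace S]
  {μ : Measure S} {E : Type*} [NormedAddCommGroup E] [NormedSpace ℝ E]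

/-- The integral over `S` of an integrable map is the (finite) sum of its integrals over the
connected components: `∫_S = Σ_j ∫_{S_j}`.  Any `Fintype` structure on the (finite, Mathlib)
type of components may be used. -/
theorem integral_eq_sum_component [Fintype (ConnectedComponents S)] {f : S → E}
    (hf : Integrable f μ) :
    ∫ x, f x ∂μ = ∑ c : ConnectedComponents S, ∫ x in component c, f x ∂μ := by
  have h := integral_iUnion (μ := μ) (f := f) (fun c => measurableSet_component c)
    pairwise_disjoint_component (by rw [iUnion_component]; exact hf.integrableOn)
  rw [iUnion_component, Measure.restrict_univ, tsum_fintype] at h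
  exact h

/-- `∫_S = Σ_j ∫_{S_j}` for a continuous map on a compact locally connected space. -/
theorem integral_eq_sum_component_of_continuous [CompactSpace S] [IsFiniteMeasureOnCompacts μ]
    [Fintype (ConnectedComponents S)] {f : S → E} (hf : Continuous f) :
    ∫ x, f x ∂μ = ∑ c : ConnectedComponents S, ∫ x in component c, f x ∂μ :=
  integral_eq_sum_component (integrable_of_continuous hf)

/-- A non-zero period on `S` is non-zero on at least one component: if `∫_S f ≠ 0` then
`∫_{S_j} f ≠ 0` for some `j`. -/
theorem exists_setIntegral_ne_zero [Fintype (ConnectedComponents S)] {f : S → E}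
    (hf : Integrable f μ) (h : ∫ x, f x ∂μ ≠ 0) :
    ∃ c : ConnectedComponents S, ∫ x in component c, f x ∂μ ≠ 0 := by
  rw [integral_eq_sum_component hf] at h
  obtain ⟨c, -, hc⟩ := Finset.exists_ne_zero_of_sum_ne_zero h
  exact ⟨c, hc⟩

/-- Conversely, if the period vanishes on every component it vanishes on `S`. -/
theorem integral_eq_zero_of_forall_component [Fintype (ConnectedComponents S)] {f : S → E}
    (hf : Integrable f μ) (h : ∀ c : ConnectedComponents S, ∫ x in component c, f x ∂μ = 0) :
    ∫ x, f x ∂μ = 0 := by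
  rw [integral_eq_sum_component hf]
  exact Finset.sum_eq_zero fun c _ => h c

/-- For a non-negative real integrand (e.g. the pointwise norm `‖α_s‖²` of a form), the integral
over `S` vanishes iff it vanishes on every component. -/
theorem integral_eq_zero_iff_forall_component [Fintype (ConnectedComponents S)] {g : S → ℝ}
    (hg : Integrable g μ) (hg0 : ∀ x, 0 ≤ g x) :
    ∫ x, g x ∂μ = 0 ↔ ∀ c : ConnectedComponents S, ∫ x in component c, g x ∂μ = 0 := by
  rw [integral_eq_sum_component hg]
  refine (Finset.sum_eq_zero_iff_of_nonneg fun c _ => ?_).trans ?_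
  · exact integral_nonneg fun x => hg0 x
  · simp only [Finset.mem_univ, true_implies]

/-- The integral of a non-negative integrand over `S` is positive iff it is positive on some
component. -/
theorem integral_pos_iff_exists_component [Fintype (ConnectedComponents S)] {g : S → ℝ}
    (hg : Integrable g μ) (hg0 : ∀ x, 0 ≤ g x) :
    0 < ∫ x, g x ∂μ ↔ ∃ c : ConnectedComponents S, 0 < ∫ x in component c, g x ∂μ := by
  have hnn : ∀ c : ConnectedComponents S, 0 ≤ ∫ x in component c, g x ∂μ :=
    fun c => integral_nonneg fun x => hg0 x
  constructor
  · intro hpos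
    by_contra hcon
    simp only [not_exists, not_lt] at hcon
    have h0 : ∀ c : ConnectedComponents S, ∫ x in component c, g x ∂μ = 0 :=
      fun c => le_antisymm (hcon c) (hnn c)
    exact hpos.ne' ((integral_eq_zero_iff_forall_component hg hg0).mpr h0)
  · rintro ⟨c, hc⟩
    rw [integral_eq_sum_component hg]
    exact lt_of_lt_of_le hc (Finset.single_le_sum (fun d _ => hnn d) (Finset.mem_univ c))

end Integral

section Pointwise

variable {E : Type*} [Zero E]

/-- A map on `S` is zero iff it is zero on every component (the set-theoretic half of
«`α = 0` on `S` iff `α|_{S_j} = 0` for all `j`»). -/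
theorem eq_zero_iff_forall_component {α : S → E} :
    α = 0 ↔ ∀ c : ConnectedComponents S, ∀ x ∈ component c, α x = 0 := by
  constructor
  · rintro rfl c x -
    rfl
  · intro h
    funext x
    exact h _ x (mem_component_mk x)

/-- A map that is non-zero somewhere on `S` is non-zero somewhere on some component. -/
theorem exists_component_exists_ne_zero {α : S → E} (h : α ≠ 0) :
    ∃ c : ConnectedComponents S, ∃ x ∈ component c, α x ≠ 0 := by
  by_contra hcon
  simp only [not_exists, not_and, not_not] at hcon
  exact h (eq_zero_iff_forall_component.mpr hcon)

end Pointwise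

end Summit.Ventures.HodgeRepro2.T5ComponentSum
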